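import Summits.QuantumFields.BalabanUV.Beta.GAN24.CombChartChargeTowerCrossed
import Summits.QuantumFields.BalabanUV.Beta.GAN24.PairFormPeriodTowerBase

/-!
# `BalabanUV.Beta.GAN24.CombChartChargeLevelZeroEvenRow` — binder row G-an2-4 ∕ (CONV-C), TRANSFER-III at row D1's literal of record (III′), the (C)-campaign in branch (i) of E0∕E1:
# **FILE L's DISPLAY (iv) — THE LEVEL `0 → 1` ROW ON THE EVEN CLASSES — FROM `hB0 0` AND THE LEVEL-`0` FORCING-SIDE CROSSED ROW `hXF 0` ALONE**: for ANY sym record with ff∕mm-free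
# border, at `cE₂ = Lc⁸`, `Tc = c • wsym22 M` (all other constants free), the comb-chart tower's leg-and-bond-symmetrised ff charge is CONSERVED from level `0` to level `1` on every EVEN
# reflection class `(κ,κ′;κ₁,κ₂)` ⟸ (a) the level-`0` comb forcing's `LS(zmode_Lc b̃′_0)` is a pair form (`hB0 0`, leaf-01's side) ∧ (b) `X(b̃′_0)(a,b) + Lc⁴·X(FF_Lc Ũ′_0)(a,b) = X(Ũ′_0)(a,b)`
# for `a ≠ b` (`hXF 0`, MY (A52) §3's currency at level `0`; ⟺ `X(b̃′_0)(a,b) = −2·Lc¹²·(Lc² − 1)` at the pins by MY (B52)).  Members `0` and `1` are pair forms by MY g40 base rows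
# (`PairFormPeriodTowerBase.pairFormLS_zmode_memberZero ∕ pairFormLS_faceRead_memberZero`, ported to the comb member `0` = the same table) and MY (A52) step row at `j = 0`; the finite
# index algebra is leaf-02's `CombChargeAntisymPairForm.flat_cov_of_pairFormLS` ⨾ `CombChargeEvenClassPatterns.families_of_flat_cov` ⨾ `evenClass_induction` BY NAME — so (iv) is NOT a
# separate display: it is the `i = 0` instance of the two forcing-side rows (i) `hB0` and `hXF` (OWNER `b2b-balaban-gan24-p1`, gen 52)

NOT IN PRINT; OUR BOOKKEEPING ([folklore] compositions BY NAME + `linarith`; 0 `def`, 0 cited facts, 0 `def … : Prop`, 0 sorry; no existing file touched).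
HONEST FRAMING (cell contract, verbatim): «discharging `BetaPertH` makes Bałaban's UV stability UNCONDITIONAL — a real constructive-QFT result; it is NOT the continuum limit and NOT the
Clay problem.»  HONEST DEPENDENCY (verbatim): «continuum YM on T⁴ ⇐ BetaPertH ∧ nine spine estimates (0/9 proved); BetaPertH ⇐ (D1) ∧ (D4) ∧ CAP+tail; G-an2-4 gates asym, D1 and
NE2/3/4.»
WHAT (`d = 3`; any sym record `tabs` with ff∕mm-free border; `cE cVH cΛ cB` free; `cE₂ = Lc⁸` where pinned; `Tc = c • wsym22 M`; `Ũ′_i := unitS₂_i T̃′♮_i`, `b̃′_0` the level-`0` comb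
forcing, `LS` the leg-and-bond symmetrisation, `X` its crossed orbit sum):
* §1 base rows at the comb data: **`pairFormLS_zmode_memberZero_comb`** (any cell `N₀`), **`pairFormLS_faceRead_memberZero_comb`** (any period `P ≥ 1`) — MY g40 rows BY NAME;
* §2 **`pairFormLS_zmode_memberOne_of_forcingPairForm`**: `LS(zmode_Lc Ũ′_1)` is a pair form ⟸ `hB0 0` (witness `T + R_face`);
* §3 **`legBondSymEven_levelZero_of_forcingPairForm_forcingCrossed`**: file L's (iv) `hcons0e` (VERBATIM shape for any sym record: `LS(zmode_Lc Ũ′_{0+1}) = LS(zmode_Lc Ũ′_0)` on the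
  even classes) ⟸ `hB0 0` ∧ `hXF 0`.
WHAT THIS IS NOT: `hB0 0` and `hXF 0` are HYPOTHESES (by value TRUE: Engine C E0, entrywise; their typed VALUE side is the `i = 0` instance of leaf-01 g85's word engine); asserts NO value of
Bałaban's tables beyond MY g40 member-`0` closed forms; discharges NOTHING of (d″) ∕ (C)_{≥1} ∕ the S-slot rows; NEVER «G-an2-4 closed» as (CONV-C); NOT D1, NOT `BetaPertH`, NOT continuum,
NOT Clay; not in print.  2026-08-27.
-/

noncomputable section

open Finset
open scoped BigOperators
open Literature.MathematicalPhysics.QuantumFieldTheory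
open Literature.MathematicalPhysics.QuantumFieldTheory.Balaban1983to89
open Literature.MathematicalPhysics.QuantumFieldTheory.Balaban1983to89.Beta
open ExpKernelCalculus (MKer comp shiftK)
open OneStepResolventKernel (Fib)
open AffineAveraging (Site box toSite)
open AveragingContoursRooted (ctr ctrOff ctrOff_mem_box)
open BalabanCompositeJets (LocStencil₂)
open SecondOrderResponse (W2SymOfK)
open BalabanStepJetsSucc (mmRead)
open BalabanStepW2 (K3OfK M2Of)
open WilsonVertex2Sym (wsym22)
open Summit.QuantumFields.BalabanUV.Beta.TameKernelCalculus (trK)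
open Summit.QuantumFields.BalabanUV.Beta.HessKerDressedUnits (unitK unitS)
open Summit.QuantumFields.BalabanUV.Beta.SecondOrderUnits (unitM unitS₂ unitM₂)
open Summit.QuantumFields.BalabanUV.Beta.AxialDressingRooted (coProjBmAtK dressKBmAt)
open Summit.QuantumFields.BalabanUV.Beta.SpineRooted (T2RecOf T2RecAt T2RecOf_zero_level T2RecAt_zero_level)
open Summit.QuantumFields.BalabanUV.Beta.SymmetrisedStepJets (SymTables)
open Summit.QuantumFields.BalabanUV.Beta.CombChartStepJets (GcombSh SpureCombOf)
open Summit.QuantumFields.BalabanUV.Beta.SymCorrectorKernel (psiKS)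
open Summit.QuantumFields.BalabanUV.Beta.SymCorrectorFace (slotPsiS)
open Summit.QuantumFields.BalabanUV.Beta.GAN24.CombesThomas (sfStep smStep)
open Summit.QuantumFields.BalabanUV.Beta.GAN24.BiStencilZeroMode (Tab zmode)
open PolarizationSign (reflSign)
open Summit.QuantumFields.BalabanUV.Beta.GAN24.CombChartChargeTowerCrossed (legBondSym_zmode_succ_eq_fourFace_free_pin crossedConserved_iff_forcingCrossed_pin_at)
open Summit.QuantumFields.BalabanUV.Beta.GAN24.PairFormPeriodTowerBase (pairFormLS_zmode_memberZero pairFormLS_faceRead_memberZero)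
open Summit.QuantumFields.BalabanUV.Beta.GAN24.CombChargeEvenClassPatterns (evenClass_induction families_of_flat_cov)
open Summit.QuantumFields.BalabanUV.Beta.GAN24.CombChargeAntisymPairForm (flat_cov_of_pairFormLS)

namespace Summit.QuantumFields.BalabanUV.Beta.GAN24.CombChartChargeLevelZeroEvenRow

variable {Lc : ℕ} [NeZero Lc]

/-! ## §1 MY g40 base rows at the comb data (member `0` is the same table: `T2RecOf_zero_level` ∕ `T2RecAt_zero_level`, both `rfl`) -/

/-- NOT IN PRINT; OUR BOOKKEEPING.  **THE `m = 0` BASE ROW AT THE COMB DATA**: at ANY cell `N₀` the leg-and-bond symmetrisation of the plain zero-mode charge of the comb-chart member `0`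
is an antisymmetric-pair form — MY g40 `PairFormPeriodTowerBase.pairFormLS_zmode_memberZero`, ported (any sym record with ff-free border; `cE cVH cΛ cE₂ cB c M` free). -/
theorem pairFormLS_zmode_memberZero_comb (tabs : SymTables 3 Lc) (N₀ : ℕ) (cE cVH cΛ cE₂ cB c : ℝ) (M : ℕ)
    (hBff : ∀ κ u κ' u' x z (α β : Fin (3 + 1)), tabs.vh₂S κ u κ' u' x z (Sum.inl α) (Sum.inl β) = 0) :
    ∃ R : Fin (3 + 1) → Fin (3 + 1) → Fin (3 + 1) → Fin (3 + 1) → ℝ,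
      (∀ a b c e : Fin (3 + 1), R b a c e = -R a b c e) ∧ (∀ a b c e : Fin (3 + 1), R a b e c = -R a b c e) ∧
      ∀ κ κ' κ₁ κ₂ : Fin (3 + 1),
        (zmode N₀ (unitS₂ (sfStep Lc 0) (smStep 3 Lc 0) (T2RecOf 3 Lc (GcombSh Lc) (SpureCombOf tabs cE cVH cΛ) tabs.M cE₂ cB (c • wsym22 M) tabs.vh₂S tabs.mixFF 0)) κ κ' (Sum.inl κ₁) (Sum.inl κ₂)
      + zmode N₀ (unitS₂ (sfStep Lc 0) (smStep 3 Lc 0) (T2RecOf 3 Lc (GcombSh Lc) (SpureCombOf tabs cE cVH cΛ) tabs.M cE₂ cB (c • wsym22 M) tabs.vh₂S tabs.mixFF 0)) κ' κ (Sum.inl κ₁) (Sum.inl κ₂)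
      + (zmode N₀ (unitS₂ (sfStep Lc 0) (smStep 3 Lc 0) (T2RecOf 3 Lc (GcombSh Lc) (SpureCombOf tabs cE cVH cΛ) tabs.M cE₂ cB (c • wsym22 M) tabs.vh₂S tabs.mixFF 0)) κ κ' (Sum.inl κ₂) (Sum.inl κ₁)
      + zmode N₀ (unitS₂ (sfStep Lc 0) (smStep 3 Lc 0) (T2RecOf 3 Lc (GcombSh Lc) (SpureCombOf tabs cE cVH cΛ) tabs.M cE₂ cB (c • wsym22 M) tabs.vh₂S tabs.mixFF 0)) κ' κ (Sum.inl κ₂) (Sum.inl κ₁)))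
          = R κ κ₁ κ' κ₂ + R κ' κ₁ κ κ₂ + (R κ κ₂ κ' κ₁ + R κ' κ₂ κ κ₁) := by
  have h := pairFormLS_zmode_memberZero (Lc := Lc) N₀ cE cVH cΛ cE₂ cB c M (toSite (ctrOff (3 + 1) Lc)) (vh₂S := tabs.vh₂S) (mixFF := tabs.mixFF) hBff
  rw [T2RecAt_zero_level] at h
  rw [T2RecOf_zero_level]
  exact h

/-- NOT IN PRINT; OUR BOOKKEEPING.  **THE BASE FACE ROW AT THE COMB DATA**: for every period `P ≥ 1` the leg-and-bond symmetrisation of `P⁴`× the plain period-`P` four exit-face read of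
the comb-chart member `0` is an antisymmetric-pair form — MY g40 `pairFormLS_faceRead_memberZero`, ported. -/
theorem pairFormLS_faceRead_memberZero_comb (tabs : SymTables 3 Lc) {P : ℕ} (hP : 1 ≤ P) (cE cVH cΛ cE₂ cB c : ℝ) (M : ℕ)
    (hBff : ∀ κ u κ' u' x z (α β : Fin (3 + 1)), tabs.vh₂S κ u κ' u' x z (Sum.inl α) (Sum.inl β) = 0) :
    ∃ R : Fin (3 + 1) → Fin (3 + 1) → Fin (3 + 1) → Fin (3 + 1) → ℝ,
      (∀ a b c e : Fin (3 + 1), R b a c e = -R a b c e) ∧ (∀ a b c e : Fin (3 + 1), R a b e c = -R a b c e) ∧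
      ∀ κ κ' κ₁ κ₂ : Fin (3 + 1),
        ((P : ℝ) ^ 4 * ∑ r' ∈ box (3 + 1) P, ∑' u' : Site (3 + 1), ∑' x : Site (3 + 1), ∑' z : Site (3 + 1), (if toSite r' κ % (P : ℤ) = (P : ℤ) - 1 ∧ u' κ' % (P : ℤ) = (P : ℤ) - 1 ∧ x κ₁ % (P : ℤ) = (P : ℤ) - 1 ∧ z κ₂ % (P : ℤ) = (P : ℤ) - 1 then unitS₂ (sfStep Lc 0) (smStep 3 Lc 0) (T2RecOf 3 Lc (GcombSh Lc) (SpureCombOf tabs cE cVH cΛ) tabs.M cE₂ cB (c • wsym22 M) tabs.vh₂S tabs.mixFF 0) κ (toSite r') κ' u' x z (Sum.inl κ₁) (Sum.inl κ₂) else 0) + (P : ℝ) ^ 4 * ∑ r' ∈ box (3 + 1) P, ∑' u' : Site (3 + 1), ∑' x : Site (3 + 1), ∑' z : Site (3 + 1), (if toSite r' κ' % (P : ℤ) = (P : ℤ) - 1 ∧ u' κ % (P : ℤ) = (P : ℤ) - 1 ∧ x κ₁ % (P : ℤ) = (P : ℤ) - 1 ∧ z κ₂ % (P : ℤ) = (P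 : ℤ) - 1 then unitS₂ (sfStep Lc 0) (smStep 3 Lc 0) (T2RecOf 3 Lc (GcombSh Lc) (SpureCombOf tabs cE cVH cΛ) tabs.M cE₂ cB (c • wsym22 M) tabs.vh₂S tabs.mixFF 0) κ' (toSite r') κ u' x z (Sum.inl κ₁) (Sum.inl κ₂) else 0)
      + ((P : ℝ) ^ 4 * ∑ r' ∈ box (3 + 1) P, ∑' u' : Site (3 + 1), ∑' x : Site (3 + 1), ∑' z : Site (3 + 1), (if toSite r' κ % (P : ℤ) = (P : ℤ) - 1 ∧ u' κ' % (P : ℤ) = (P : ℤ) - 1 ∧ x κ₂ % (P : ℤ) = (P : ℤ) - 1 ∧ z κ₁ % (P : ℤ) = (P : ℤ) - 1 then unitS₂ (sfStep Lc 0) (smStep 3 Lc 0) (T2RecOf 3 Lc (GcombSh Lc) (SpureCombOf tabs cE cVH cΛ) tabs.M cE₂ cB (c • wsym22 M) tabs.vh₂S tabs.mixFF 0) κ (toSite r') κ' u' x z (Sum.inl κ₂) (Sum.inl κ₁) else 0) + (P : ℝ) ^ 4 * ∑ r' ∈ box (3 + 1) P, ∑' u' : Site (3 + 1), ∑' x :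 Site (3 + 1), ∑' z : Site (3 + 1), (if toSite r' κ' % (P : ℤ) = (P : ℤ) - 1 ∧ u' κ % (P : ℤ) = (P : ℤ) - 1 ∧ x κ₂ % (P : ℤ) = (P : ℤ) - 1 ∧ z κ₁ % (P : ℤ) = (P : ℤ) - 1 then unitS₂ (sfStep Lc 0) (smStep 3 Lc 0) (T2RecOf 3 Lc (GcombSh Lc) (SpureCombOf tabs cE cVH cΛ) tabs.M cE₂ cB (c • wsym22 M) tabs.vh₂S tabs.mixFF 0) κ' (toSite r') κ u' x z (Sum.inl κ₂) (Sum.inl κ₁) else 0)))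
          = R κ κ₁ κ' κ₂ + R κ' κ₁ κ κ₂ + (R κ κ₂ κ' κ₁ + R κ' κ₂ κ κ₁) := by
  have h := pairFormLS_faceRead_memberZero (Lc := Lc) hP cE cVH cΛ cE₂ cB c M (toSite (ctrOff (3 + 1) Lc)) (vh₂S := tabs.vh₂S) (mixFF := tabs.mixFF) hBff
  rw [T2RecAt_zero_level] at h
  rw [T2RecOf_zero_level]
  exact h

/-! ## §2 Member `1` is a pair form ⟸ `hB0 0` -/

/-- NOT IN PRINT; OUR BOOKKEEPING.  **`LS(zmode_Lc Ũ′_1)` IS A PAIR FORM ⟸ THE LEVEL-`0` COMB FORCING's IS** (`cE₂ = Lc⁸`; witness `T + R_face`): MY (A52)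
`legBondSym_zmode_succ_eq_fourFace_free_pin` at `j = 0` (`LS(zmode_Lc Ũ′_1) = LS(zmode_Lc b̃′_0) + Lc⁴·LS(FF_Lc Ũ′_0)`) with `hB0 0` and §1's base face row at `P = Lc`. -/
theorem pairFormLS_zmode_memberOne_of_forcingPairForm (tabs : SymTables 3 Lc) (cE cVH cΛ : ℝ) {cE₂ : ℝ} (cB : ℝ) (hcE₂ : cE₂ = (Lc : ℝ) ^ (2 * (3 + 1))) (c : ℝ) (M : ℕ)
    (hBff : ∀ κ u κ' u' x z (α β : Fin (3 + 1)), tabs.vh₂S κ u κ' u' x z (Sum.inl α) (Sum.inl β) = 0)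
    (hBmm : ∀ κ u κ' u' x z (μ ν : Fin (3 + 1)), tabs.vh₂S κ u κ' u' x z (Sum.inr μ) (Sum.inr ν) = 0)
    (hB00 : ∃ T : Fin (3 + 1) → Fin (3 + 1) → Fin (3 + 1) → Fin (3 + 1) → ℝ,
      (∀ a b c e : Fin (3 + 1), T b a c e = -T a b c e) ∧ (∀ a b c e : Fin (3 + 1), T a b e c = -T a b c e) ∧
      ∀ κ κ' κ₁ κ₂ : Fin (3 + 1),
        (zmode Lc (fun κ u κ' u' => (cE₂ * (Lc : ℝ) ^ (2 * (3 + 1))) • mmRead Lc (K3OfK (unitK (sfStep Lc 0) (smStep 3 Lc 0) (GcombSh (d := 3) Lc 0)) Lc (unitS (sfStep Lc 0) (smStep 3 Lc 0) (SpureCombOf tabs cE cVH cΛ 0)) (unitM (sfStep Lc 0) (smStep 3 Lc 0) (tabs.M 0)) (W2SymOfK (unitK (sfStep Lc 0) (smStep 3 Lc 0) (GcombSh (d := 3) Lc 0)) Lc (unitS (sfStep Lc 0) (smStep 3 Lc 0) (SpureCombOf tabs cE cVH cΛ 0)) (unitM (sfStep Lc 0) (smStep 3 Lc 0) (tabs.M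 0)) 0 (unitM₂ (sfStep Lc 0) (smStep 3 Lc 0) (M2Of 3 Lc tabs.mixFF 0))) κ u κ' u') + cB • tabs.vh₂S κ u κ' u') κ κ' (Sum.inl κ₁) (Sum.inl κ₂)
      + zmode Lc (fun κ u κ' u' => (cE₂ * (Lc : ℝ) ^ (2 * (3 + 1))) • mmRead Lc (K3OfK (unitK (sfStep Lc 0) (smStep 3 Lc 0) (GcombSh (d := 3) Lc 0)) Lc (unitS (sfStep Lc 0) (smStep 3 Lc 0) (SpureCombOf tabs cE cVH cΛ 0)) (unitM (sfStep Lc 0) (smStep 3 Lc 0) (tabs.M 0)) (W2SymOfK (unitK (sfStep Lc 0) (smStep 3 Lc 0) (GcombSh (d := 3) Lc 0)) Lc (unitS (sfStep Lc 0) (smStep 3 Lc 0) (SpureCombOf tabs cE cVH cΛ 0)) (unitM (sfStep Lc 0) (smStep 3 Lc 0) (tabs.M 0)) 0 (unitM₂ (sfStep Lc 0) (smStep 3 Lc 0) (M2Of 3 Lc tabs.mixFF 0))) κ u κ' u') + cB • tabs.vh₂S κ u κ' u') κ' κ (Sum.inl κ₁) (Sum.inl κ₂)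
      + (zmode Lc (fun κ u κ' u' => (cE₂ * (Lc : ℝ) ^ (2 * (3 + 1))) • mmRead Lc (K3OfK (unitK (sfStep Lc 0) (smStep 3 Lc 0) (GcombSh (d := 3) Lc 0)) Lc (unitS (sfStep Lc 0) (smStep 3 Lc 0) (SpureCombOf tabs cE cVH cΛ 0)) (unitM (sfStep Lc 0) (smStep 3 Lc 0) (tabs.M 0)) (W2SymOfK (unitK (sfStep Lc 0) (smStep 3 Lc 0) (GcombSh (d := 3) Lc 0)) Lc (unitS (sfStep Lc 0) (smStep 3 Lc 0) (SpureCombOf tabs cE cVH cΛ 0)) (unitM (sfStep Lc 0) (smStep 3 Lc 0) (tabs.M 0)) 0 (unitM₂ (sfStep Lc 0) (smStep 3 Lc 0) (M2Of 3 Lc tabs.mixFF 0))) κ u κ' u') + cB • tabs.vh₂S κ u κ' u') κ κ' (Sum.inl κ₂) (Sum.inl κ₁)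
      + zmode Lc (fun κ u κ' u' => (cE₂ * (Lc : ℝ) ^ (2 * (3 + 1))) • mmRead Lc (K3OfK (unitK (sfStep Lc 0) (smStep 3 Lc 0) (GcombSh (d := 3) Lc 0)) Lc (unitS (sfStep Lc 0) (smStep 3 Lc 0) (SpureCombOf tabs cE cVH cΛ 0)) (unitM (sfStep Lc 0) (smStep 3 Lc 0) (tabs.M 0)) (W2SymOfK (unitK (sfStep Lc 0) (smStep 3 Lc 0) (GcombSh (d := 3) Lc 0)) Lc (unitS (sfStep Lc 0) (smStep 3 Lc 0) (SpureCombOf tabs cE cVH cΛ 0)) (unitM (sfStep Lc 0) (smStep 3 Lc 0) (tabs.M 0)) 0 (unitM₂ (sfStep Lc 0) (smStep 3 Lc 0) (M2Of 3 Lc tabs.mixFF 0))) κ u κ' u') + cB • tabs.vh₂S κ u κ' u') κ' κ (Sum.inl κ₂) (Sum.inl κ₁)))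
          = T κ κ₁ κ' κ₂ + T κ' κ₁ κ κ₂ + (T κ κ₂ κ' κ₁ + T κ' κ₂ κ κ₁)) :
    ∃ R : Fin (3 + 1) → Fin (3 + 1) → Fin (3 + 1) → Fin (3 + 1) → ℝ,
      (∀ a b c e : Fin (3 + 1), R b a c e = -R a b c e) ∧ (∀ a b c e : Fin (3 + 1), R a b e c = -R a b c e) ∧
      ∀ κ κ' κ₁ κ₂ : Fin (3 + 1),
        (zmode Lc (unitS₂ (sfStep Lc (0 + 1)) (smStep 3 Lc (0 + 1)) (T2RecOf 3 Lc (GcombSh Lc) (SpureCombOf tabs cE cVH cΛ) tabs.M cE₂ cB (c • wsym22 M) tabs.vh₂S tabs.mixFF (0 + 1))) κ κ' (Sum.inl κ₁) (Sum.inl κ₂)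
      + zmode Lc (unitS₂ (sfStep Lc (0 + 1)) (smStep 3 Lc (0 + 1)) (T2RecOf 3 Lc (GcombSh Lc) (SpureCombOf tabs cE cVH cΛ) tabs.M cE₂ cB (c • wsym22 M) tabs.vh₂S tabs.mixFF (0 + 1))) κ' κ (Sum.inl κ₁) (Sum.inl κ₂)
      + (zmode Lc (unitS₂ (sfStep Lc (0 + 1)) (smStep 3 Lc (0 + 1)) (T2RecOf 3 Lc (GcombSh Lc) (SpureCombOf tabs cE cVH cΛ) tabs.M cE₂ cB (c • wsym22 M) tabs.vh₂S tabs.mixFF (0 + 1))) κ κ' (Sum.inl κ₂) (Sum.inl κ₁)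
      + zmode Lc (unitS₂ (sfStep Lc (0 + 1)) (smStep 3 Lc (0 + 1)) (T2RecOf 3 Lc (GcombSh Lc) (SpureCombOf tabs cE cVH cΛ) tabs.M cE₂ cB (c • wsym22 M) tabs.vh₂S tabs.mixFF (0 + 1))) κ' κ (Sum.inl κ₂) (Sum.inl κ₁)))
          = R κ κ₁ κ' κ₂ + R κ' κ₁ κ κ₂ + (R κ κ₂ κ' κ₁ + R κ' κ₂ κ κ₁) := by
  have hLc1 : 1 ≤ Lc := Nat.one_le_iff_ne_zero.mpr (NeZero.ne Lc)
  obtain ⟨T, hT1, hT2, hT⟩ := hB00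
  obtain ⟨S, hS1, hS2, hS⟩ := pairFormLS_faceRead_memberZero_comb tabs (P := Lc) hLc1 cE cVH cΛ cE₂ cB c M hBff
  refine ⟨fun p q s t => T p q s t + S p q s t, fun p q s t => ?_, fun p q s t => ?_, fun κ κ' κ₁ κ₂ => ?_⟩
  · dsimp only; rw [hT1, hS1]; ring
  · dsimp only; rw [hT2, hS2]; ring
  · have h := legBondSym_zmode_succ_eq_fourFace_free_pin tabs cE cVH cΛ cB hcE₂ (c • wsym22 M) hBff hBmm 0 κ κ' κ₁ κ₂
    rw [hT κ κ' κ₁ κ₂, hS κ κ' κ₁ κ₂] at h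
    dsimp only
    linarith

/-! ## §3 File L's display (iv) from `hB0 0` ∧ `hXF 0` -/

set_option maxHeartbeats 400000 in
/-- NOT IN PRINT; OUR BOOKKEEPING.  **THE LEVEL `0 → 1` ROW ON THE EVEN CLASSES ⟸ `hB0 0` ∧ `hXF 0`** (`cE₂ = Lc⁸`, `Tc = c • wsym22 M`, any sym record with ff∕mm-free border; file L's
(iv) `hcons0e` VERBATIM shape): both members are pair forms (§1, §2), so by leaf-02's `flat_cov_of_pairFormLS` their all-equal ∕ diagonal ∕ flat letters hold, and the crossed orbit sums
agree by `hXF 0` through MY (A52) `crossedConserved_iff_forcingCrossed_pin_at` at `j = 0`; `families_of_flat_cov` ⨾ `evenClass_induction` close every even class. -/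
theorem legBondSymEven_levelZero_of_forcingPairForm_forcingCrossed (tabs : SymTables 3 Lc) (cE cVH cΛ : ℝ) {cE₂ : ℝ} (cB : ℝ) (hcE₂ : cE₂ = (Lc : ℝ) ^ (2 * (3 + 1))) (c : ℝ) (M : ℕ)
    (hBff : ∀ κ u κ' u' x z (α β : Fin (3 + 1)), tabs.vh₂S κ u κ' u' x z (Sum.inl α) (Sum.inl β) = 0)
    (hBmm : ∀ κ u κ' u' x z (μ ν : Fin (3 + 1)), tabs.vh₂S κ u κ' u' x z (Sum.inr μ) (Sum.inr ν) = 0)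
    (hB00 : ∃ T : Fin (3 + 1) → Fin (3 + 1) → Fin (3 + 1) → Fin (3 + 1) → ℝ,
      (∀ a b c e : Fin (3 + 1), T b a c e = -T a b c e) ∧ (∀ a b c e : Fin (3 + 1), T a b e c = -T a b c e) ∧
      ∀ κ κ' κ₁ κ₂ : Fin (3 + 1),
        (zmode Lc (fun κ u κ' u' => (cE₂ * (Lc : ℝ) ^ (2 * (3 + 1))) • mmRead Lc (K3OfK (unitK (sfStep Lc 0) (smStep 3 Lc 0) (GcombSh (d := 3) Lc 0)) Lc (unitS (sfStep Lc 0) (smStep 3 Lc 0) (SpureCombOf tabs cE cVH cΛ 0)) (unitM (sfStep Lc 0) (smStep 3 Lc 0) (tabs.M 0)) (W2SymOfK (unitK (sfStep Lc 0) (smStep 3 Lc 0) (GcombSh (d := 3) Lc 0)) Lc (unitS (sfStep Lc 0) (smStep 3 Lc 0) (SpureCombOf tabs cE cVH cΛ 0)) (unitM (sfStep Lc 0) (smStep 3 Lc 0) (tabs.M 0)) 0 (unitM₂ (sfStep Lc 0) (smStep 3 Lc 0) (M2Of 3 Lc tabs.mixFF 0))) κ u κ' u') + cB • tabs.vh₂S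 κ u κ' u') κ κ' (Sum.inl κ₁) (Sum.inl κ₂)
      + zmode Lc (fun κ u κ' u' => (cE₂ * (Lc : ℝ) ^ (2 * (3 + 1))) • mmRead Lc (K3OfK (unitK (sfStep Lc 0) (smStep 3 Lc 0) (GcombSh (d := 3) Lc 0)) Lc (unitS (sfStep Lc 0) (smStep 3 Lc 0) (SpureCombOf tabs cE cVH cΛ 0)) (unitM (sfStep Lc 0) (smStep 3 Lc 0) (tabs.M 0)) (W2SymOfK (unitK (sfStep Lc 0) (smStep 3 Lc 0) (GcombSh (d := 3) Lc 0)) Lc (unitS (sfStep Lc 0) (smStep 3 Lc 0) (SpureCombOf tabs cE cVH cΛ 0)) (unitM (sfStep Lc 0) (smStep 3 Lc 0) (tabs.M 0)) 0 (unitM₂ (sfStep Lc 0) (smStep 3 Lc 0) (M2Of 3 Lc tabs.mixFF 0))) κ u κ' u') + cB • tabs.vh₂S κ u κ' u') κ' κ (Sum.inl κ₁) (Sum.inl κ₂)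
      + (zmode Lc (fun κ u κ' u' => (cE₂ * (Lc : ℝ) ^ (2 * (3 + 1))) • mmRead Lc (K3OfK (unitK (sfStep Lc 0) (smStep 3 Lc 0) (GcombSh (d := 3) Lc 0)) Lc (unitS (sfStep Lc 0) (smStep 3 Lc 0) (SpureCombOf tabs cE cVH cΛ 0)) (unitM (sfStep Lc 0) (smStep 3 Lc 0) (tabs.M 0)) (W2SymOfK (unitK (sfStep Lc 0) (smStep 3 Lc 0) (GcombSh (d := 3) Lc 0)) Lc (unitS (sfStep Lc 0) (smStep 3 Lc 0) (SpureCombOf tabs cE cVH cΛ 0)) (unitM (sfStep Lc 0) (smStep 3 Lc 0) (tabs.M 0)) 0 (unitM₂ (sfStep Lc 0) (smStep 3 Lc 0) (M2Of 3 Lc tabs.mixFF 0))) κ u κ' u') + cB • tabs.vh₂S κ u κ' u') κ κ' (Sum.inl κ₂) (Sum.inl κ₁)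
      + zmode Lc (fun κ u κ' u' => (cE₂ * (Lc : ℝ) ^ (2 * (3 + 1))) • mmRead Lc (K3OfK (unitK (sfStep Lc 0) (smStep 3 Lc 0) (GcombSh (d := 3) Lc 0)) Lc (unitS (sfStep Lc 0) (smStep 3 Lc 0) (SpureCombOf tabs cE cVH cΛ 0)) (unitM (sfStep Lc 0) (smStep 3 Lc 0) (tabs.M 0)) (W2SymOfK (unitK (sfStep Lc 0) (smStep 3 Lc 0) (GcombSh (d := 3) Lc 0)) Lc (unitS (sfStep Lc 0) (smStep 3 Lc 0) (SpureCombOf tabs cE cVH cΛ 0)) (unitM (sfStep Lc 0) (smStep 3 Lc 0) (tabs.M 0)) 0 (unitM₂ (sfStep Lc 0) (smStep 3 Lc 0) (M2Of 3 Lc tabs.mixFF 0))) κ u κ' u') + cB • tabs.vh₂S κ u κ' u') κ' κ (Sum.inl κ₂) (Sum.inl κ₁)))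
          = T κ κ₁ κ' κ₂ + T κ' κ₁ κ κ₂ + (T κ κ₂ κ' κ₁ + T κ' κ₂ κ κ₁))
    (hXF0 : ∀ (a b : Fin (3 + 1)), a ≠ b →
      (zmode Lc (fun κ u κ' u' => (cE₂ * (Lc : ℝ) ^ (2 * (3 + 1))) • mmRead Lc (K3OfK (unitK (sfStep Lc 0) (smStep 3 Lc 0) (GcombSh (d := 3) Lc 0)) Lc (unitS (sfStep Lc 0) (smStep 3 Lc 0) (SpureCombOf tabs cE cVH cΛ 0)) (unitM (sfStep Lc 0) (smStep 3 Lc 0) (tabs.M 0)) (W2SymOfK (unitK (sfStep Lc 0) (smStep 3 Lc 0) (GcombSh (d := 3) Lc 0)) Lc (unitS (sfStep Lc 0) (smStep 3 Lc 0) (SpureCombOf tabs cE cVH cΛ 0)) (unitM (sfStep Lc 0) (smStep 3 Lc 0) (tabs.M 0)) 0 (unitM₂ (sfStep Lc 0) (smStep 3 Lc 0) (M2Of 3 Lc tabs.mixFF 0))) κ u κ' u') + cB • tabs.vh₂S κ u κ' u') a b (Sum.inl a) (Sum.inl b)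
      + zmode Lc (fun κ u κ' u' => (cE₂ * (Lc : ℝ) ^ (2 * (3 + 1))) • mmRead Lc (K3OfK (unitK (sfStep Lc 0) (smStep 3 Lc 0) (GcombSh (d := 3) Lc 0)) Lc (unitS (sfStep Lc 0) (smStep 3 Lc 0) (SpureCombOf tabs cE cVH cΛ 0)) (unitM (sfStep Lc 0) (smStep 3 Lc 0) (tabs.M 0)) (W2SymOfK (unitK (sfStep Lc 0) (smStep 3 Lc 0) (GcombSh (d := 3) Lc 0)) Lc (unitS (sfStep Lc 0) (smStep 3 Lc 0) (SpureCombOf tabs cE cVH cΛ 0)) (unitM (sfStep Lc 0) (smStep 3 Lc 0) (tabs.M 0)) 0 (unitM₂ (sfStep Lc 0) (smStep 3 Lc 0) (M2Of 3 Lc tabs.mixFF 0))) κ u κ' u') + cB • tabs.vh₂S κ u κ' u') b a (Sum.inl a) (Sum.inl b)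
      + (zmode Lc (fun κ u κ' u' => (cE₂ * (Lc : ℝ) ^ (2 * (3 + 1))) • mmRead Lc (K3OfK (unitK (sfStep Lc 0) (smStep 3 Lc 0) (GcombSh (d := 3) Lc 0)) Lc (unitS (sfStep Lc 0) (smStep 3 Lc 0) (SpureCombOf tabs cE cVH cΛ 0)) (unitM (sfStep Lc 0) (smStep 3 Lc 0) (tabs.M 0)) (W2SymOfK (unitK (sfStep Lc 0) (smStep 3 Lc 0) (GcombSh (d := 3) Lc 0)) Lc (unitS (sfStep Lc 0) (smStep 3 Lc 0) (SpureCombOf tabs cE cVH cΛ 0)) (unitM (sfStep Lc 0) (smStep 3 Lc 0) (tabs.M 0)) 0 (unitM₂ (sfStep Lc 0) (smStep 3 Lc 0) (M2Of 3 Lc tabs.mixFF 0))) κ u κ' u') + cB • tabs.vh₂S κ u κ' u') a b (Sum.inl b) (Sum.inl a)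
      + zmode Lc (fun κ u κ' u' => (cE₂ * (Lc : ℝ) ^ (2 * (3 + 1))) • mmRead Lc (K3OfK (unitK (sfStep Lc 0) (smStep 3 Lc 0) (GcombSh (d := 3) Lc 0)) Lc (unitS (sfStep Lc 0) (smStep 3 Lc 0) (SpureCombOf tabs cE cVH cΛ 0)) (unitM (sfStep Lc 0) (smStep 3 Lc 0) (tabs.M 0)) (W2SymOfK (unitK (sfStep Lc 0) (smStep 3 Lc 0) (GcombSh (d := 3) Lc 0)) Lc (unitS (sfStep Lc 0) (smStep 3 Lc 0) (SpureCombOf tabs cE cVH cΛ 0)) (unitM (sfStep Lc 0) (smStep 3 Lc 0) (tabs.M 0)) 0 (unitM₂ (sfStep Lc 0) (smStep 3 Lc 0) (M2Of 3 Lc tabs.mixFF 0))) κ u κ' u') + cB • tabs.vh₂S κ u κ' u') b a (Sum.inl b) (Sum.inl a)))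
        + ((Lc : ℝ) ^ 4 * ∑ r' ∈ box (3 + 1) Lc, ∑' u' : Site (3 + 1), ∑' x : Site (3 + 1), ∑' z : Site (3 + 1), (if toSite r' a % (Lc : ℤ) = (Lc : ℤ) - 1 ∧ u' b % (Lc : ℤ) = (Lc : ℤ) - 1 ∧ x a % (Lc : ℤ) = (Lc : ℤ) - 1 ∧ z b % (Lc : ℤ) = (Lc : ℤ) - 1 then unitS₂ (sfStep Lc 0) (smStep 3 Lc 0) (T2RecOf 3 Lc (GcombSh Lc) (SpureCombOf tabs cE cVH cΛ) tabs.M cE₂ cB (c • wsym22 M) tabs.vh₂S tabs.mixFF 0) a (toSite r') b u' x z (Sum.inl a) (Sum.inl b) else 0) + (Lc : ℝ) ^ 4 * ∑ r' ∈ box (3 + 1) Lc, ∑' u' : Site (3 + 1), ∑' x : Site (3 + 1), ∑' z : Site (3 + 1), (if toSite r' b % (Lc : ℤ) = (Lc : ℤ) - 1 ∧ u' a % (Lc : ℤ) = (Lc : ℤ) - 1 ∧ x a % (Lc : ℤ) = (Lc : ℤ) - 1 ∧ z b % (Lc : ℤ) = (Lc : ℤ) - 1 then unitS₂ (sfStep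 Lc 0) (smStep 3 Lc 0) (T2RecOf 3 Lc (GcombSh Lc) (SpureCombOf tabs cE cVH cΛ) tabs.M cE₂ cB (c • wsym22 M) tabs.vh₂S tabs.mixFF 0) b (toSite r') a u' x z (Sum.inl a) (Sum.inl b) else 0)
      + ((Lc : ℝ) ^ 4 * ∑ r' ∈ box (3 + 1) Lc, ∑' u' : Site (3 + 1), ∑' x : Site (3 + 1), ∑' z : Site (3 + 1), (if toSite r' a % (Lc : ℤ) = (Lc : ℤ) - 1 ∧ u' b % (Lc : ℤ) = (Lc : ℤ) - 1 ∧ x b % (Lc : ℤ) = (Lc : ℤ) - 1 ∧ z a % (Lc : ℤ) = (Lc : ℤ) - 1 then unitS₂ (sfStep Lc 0) (smStep 3 Lc 0) (T2RecOf 3 Lc (GcombSh Lc) (SpureCombOf tabs cE cVH cΛ) tabs.M cE₂ cB (c • wsym22 M) tabs.vh₂S tabs.mixFF 0) a (toSite r') b u' x z (Sum.inl b) (Sum.inl a) else 0) + (Lc : ℝ) ^ 4 * ∑ r' ∈ box (3 + 1) Lc, ∑' u' : Site (3 + 1), ∑' x : Site (3 + 1), ∑' z : Site (3 + 1), (if toSite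 r' b % (Lc : ℤ) = (Lc : ℤ) - 1 ∧ u' a % (Lc : ℤ) = (Lc : ℤ) - 1 ∧ x b % (Lc : ℤ) = (Lc : ℤ) - 1 ∧ z a % (Lc : ℤ) = (Lc : ℤ) - 1 then unitS₂ (sfStep Lc 0) (smStep 3 Lc 0) (T2RecOf 3 Lc (GcombSh Lc) (SpureCombOf tabs cE cVH cΛ) tabs.M cE₂ cB (c • wsym22 M) tabs.vh₂S tabs.mixFF 0) b (toSite r') a u' x z (Sum.inl b) (Sum.inl a) else 0)))
      = (zmode Lc (unitS₂ (sfStep Lc 0) (smStep 3 Lc 0) (T2RecOf 3 Lc (GcombSh Lc) (SpureCombOf tabs cE cVH cΛ) tabs.M cE₂ cB (c • wsym22 M) tabs.vh₂S tabs.mixFF 0)) a b (Sum.inl a) (Sum.inl b)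
      + zmode Lc (unitS₂ (sfStep Lc 0) (smStep 3 Lc 0) (T2RecOf 3 Lc (GcombSh Lc) (SpureCombOf tabs cE cVH cΛ) tabs.M cE₂ cB (c • wsym22 M) tabs.vh₂S tabs.mixFF 0)) b a (Sum.inl a) (Sum.inl b)
      + (zmode Lc (unitS₂ (sfStep Lc 0) (smStep 3 Lc 0) (T2RecOf 3 Lc (GcombSh Lc) (SpureCombOf tabs cE cVH cΛ) tabs.M cE₂ cB (c • wsym22 M) tabs.vh₂S tabs.mixFF 0)) a b (Sum.inl b) (Sum.inl a)
      + zmode Lc (unitS₂ (sfStep Lc 0) (smStep 3 Lc 0) (T2RecOf 3 Lc (GcombSh Lc) (SpureCombOf tabs cE cVH cΛ) tabs.M cE₂ cB (c • wsym22 M) tabs.vh₂S tabs.mixFF 0)) b a (Sum.inl b) (Sum.inl a))))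
    (κ κ' κ₁ κ₂ : Fin (3 + 1)) (heven : ¬ ∃ α : Fin 4, reflSign α κ * reflSign α κ' * reflSign α κ₁ * reflSign α κ₂ = -1) :
    (zmode Lc (unitS₂ (sfStep Lc (0 + 1)) (smStep 3 Lc (0 + 1)) (T2RecOf 3 Lc (GcombSh Lc) (SpureCombOf tabs cE cVH cΛ) tabs.M cE₂ cB (c • wsym22 M) tabs.vh₂S tabs.mixFF (0 + 1))) κ κ' (Sum.inl κ₁) (Sum.inl κ₂)
      + zmode Lc (unitS₂ (sfStep Lc (0 + 1)) (smStep 3 Lc (0 + 1)) (T2RecOf 3 Lc (GcombSh Lc) (SpureCombOf tabs cE cVH cΛ) tabs.M cE₂ cB (c • wsym22 M) tabs.vh₂S tabs.mixFF (0 + 1))) κ' κ (Sum.inl κ₁) (Sum.inl κ₂)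
      + (zmode Lc (unitS₂ (sfStep Lc (0 + 1)) (smStep 3 Lc (0 + 1)) (T2RecOf 3 Lc (GcombSh Lc) (SpureCombOf tabs cE cVH cΛ) tabs.M cE₂ cB (c • wsym22 M) tabs.vh₂S tabs.mixFF (0 + 1))) κ κ' (Sum.inl κ₂) (Sum.inl κ₁)
      + zmode Lc (unitS₂ (sfStep Lc (0 + 1)) (smStep 3 Lc (0 + 1)) (T2RecOf 3 Lc (GcombSh Lc) (SpureCombOf tabs cE cVH cΛ) tabs.M cE₂ cB (c • wsym22 M) tabs.vh₂S tabs.mixFF (0 + 1))) κ' κ (Sum.inl κ₂) (Sum.inl κ₁)))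
      = (zmode Lc (unitS₂ (sfStep Lc 0) (smStep 3 Lc 0) (T2RecOf 3 Lc (GcombSh Lc) (SpureCombOf tabs cE cVH cΛ) tabs.M cE₂ cB (c • wsym22 M) tabs.vh₂S tabs.mixFF 0)) κ κ' (Sum.inl κ₁) (Sum.inl κ₂)
      + zmode Lc (unitS₂ (sfStep Lc 0) (smStep 3 Lc 0) (T2RecOf 3 Lc (GcombSh Lc) (SpureCombOf tabs cE cVH cΛ) tabs.M cE₂ cB (c • wsym22 M) tabs.vh₂S tabs.mixFF 0)) κ' κ (Sum.inl κ₁) (Sum.inl κ₂)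
      + (zmode Lc (unitS₂ (sfStep Lc 0) (smStep 3 Lc 0) (T2RecOf 3 Lc (GcombSh Lc) (SpureCombOf tabs cE cVH cΛ) tabs.M cE₂ cB (c • wsym22 M) tabs.vh₂S tabs.mixFF 0)) κ κ' (Sum.inl κ₂) (Sum.inl κ₁)
      + zmode Lc (unitS₂ (sfStep Lc 0) (smStep 3 Lc 0) (T2RecOf 3 Lc (GcombSh Lc) (SpureCombOf tabs cE cVH cΛ) tabs.M cE₂ cB (c • wsym22 M) tabs.vh₂S tabs.mixFF 0)) κ' κ (Sum.inl κ₂) (Sum.inl κ₁))) := by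
  obtain ⟨R1, hR11, hR12, hE1⟩ := pairFormLS_zmode_memberOne_of_forcingPairForm tabs cE cVH cΛ cB hcE₂ c M hBff hBmm hB00
  obtain ⟨R0, hR01, hR02, hE0⟩ := pairFormLS_zmode_memberZero_comb tabs Lc cE cVH cΛ cE₂ cB c M hBff
  have fc1 := flat_cov_of_pairFormLS (A := (fun κ κ' κ₁ κ₂ => zmode Lc (unitS₂ (sfStep Lc (0 + 1)) (smStep 3 Lc (0 + 1)) (T2RecOf 3 Lc (GcombSh Lc) (SpureCombOf tabs cE cVH cΛ) tabs.M cE₂ cB (c • wsym22 M) tabs.vh₂S tabs.mixFF (0 + 1))) κ κ' (Sum.inl κ₁) (Sum.inl κ₂))) hE1 hR11 hR12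
  have fc0 := flat_cov_of_pairFormLS (A := (fun κ κ' κ₁ κ₂ => zmode Lc (unitS₂ (sfStep Lc 0) (smStep 3 Lc 0) (T2RecOf 3 Lc (GcombSh Lc) (SpureCombOf tabs cE cVH cΛ) tabs.M cE₂ cB (c • wsym22 M) tabs.vh₂S tabs.mixFF 0)) κ κ' (Sum.inl κ₁) (Sum.inl κ₂))) hE0 hR01 hR02
  have hXc : ∀ (a b : Fin (3 + 1)), a ≠ b →
      (zmode Lc (unitS₂ (sfStep Lc (0 + 1)) (smStep 3 Lc (0 + 1)) (T2RecOf 3 Lc (GcombSh Lc) (SpureCombOf tabs cE cVH cΛ) tabs.M cE₂ cB (c • wsym22 M) tabs.vh₂S tabs.mixFF (0 + 1))) a b (Sum.inl a) (Sum.inl b)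
      + zmode Lc (unitS₂ (sfStep Lc (0 + 1)) (smStep 3 Lc (0 + 1)) (T2RecOf 3 Lc (GcombSh Lc) (SpureCombOf tabs cE cVH cΛ) tabs.M cE₂ cB (c • wsym22 M) tabs.vh₂S tabs.mixFF (0 + 1))) b a (Sum.inl a) (Sum.inl b)
      + (zmode Lc (unitS₂ (sfStep Lc (0 + 1)) (smStep 3 Lc (0 + 1)) (T2RecOf 3 Lc (GcombSh Lc) (SpureCombOf tabs cE cVH cΛ) tabs.M cE₂ cB (c • wsym22 M) tabs.vh₂S tabs.mixFF (0 + 1))) a b (Sum.inl b) (Sum.inl a)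
      + zmode Lc (unitS₂ (sfStep Lc (0 + 1)) (smStep 3 Lc (0 + 1)) (T2RecOf 3 Lc (GcombSh Lc) (SpureCombOf tabs cE cVH cΛ) tabs.M cE₂ cB (c • wsym22 M) tabs.vh₂S tabs.mixFF (0 + 1))) b a (Sum.inl b) (Sum.inl a)))
      = (zmode Lc (unitS₂ (sfStep Lc 0) (smStep 3 Lc 0) (T2RecOf 3 Lc (GcombSh Lc) (SpureCombOf tabs cE cVH cΛ) tabs.M cE₂ cB (c • wsym22 M) tabs.vh₂S tabs.mixFF 0)) a b (Sum.inl a) (Sum.inl b)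
      + zmode Lc (unitS₂ (sfStep Lc 0) (smStep 3 Lc 0) (T2RecOf 3 Lc (GcombSh Lc) (SpureCombOf tabs cE cVH cΛ) tabs.M cE₂ cB (c • wsym22 M) tabs.vh₂S tabs.mixFF 0)) b a (Sum.inl a) (Sum.inl b)
      + (zmode Lc (unitS₂ (sfStep Lc 0) (smStep 3 Lc 0) (T2RecOf 3 Lc (GcombSh Lc) (SpureCombOf tabs cE cVH cΛ) tabs.M cE₂ cB (c • wsym22 M) tabs.vh₂S tabs.mixFF 0)) a b (Sum.inl b) (Sum.inl a)
      + zmode Lc (unitS₂ (sfStep Lc 0) (smStep 3 Lc 0) (T2RecOf 3 Lc (GcombSh Lc) (SpureCombOf tabs cE cVH cΛ) tabs.M cE₂ cB (c • wsym22 M) tabs.vh₂S tabs.mixFF 0)) b a (Sum.inl b) (Sum.inl a))) := fun a b hab =>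
    (crossedConserved_iff_forcingCrossed_pin_at tabs cE cVH cΛ cB hcE₂ (c • wsym22 M) hBff hBmm 0 a b).mpr (hXF0 a b hab)
  obtain ⟨hWf, hYf, hXf⟩ := families_of_flat_cov (A := (fun κ κ' κ₁ κ₂ => zmode Lc (unitS₂ (sfStep Lc (0 + 1)) (smStep 3 Lc (0 + 1)) (T2RecOf 3 Lc (GcombSh Lc) (SpureCombOf tabs cE cVH cΛ) tabs.M cE₂ cB (c • wsym22 M) tabs.vh₂S tabs.mixFF (0 + 1))) κ κ' (Sum.inl κ₁) (Sum.inl κ₂))) (B := (fun κ κ' κ₁ κ₂ => zmode Lc (unitS₂ (sfStep Lc 0) (smStep 3 Lc 0) (T2RecOf 3 Lc (GcombSh Lc) (SpureCombOf tabs cE cVH cΛ) tabs.M cE₂ cB (c • wsym22 M) tabs.vh₂S tabs.mixFF 0)) κ κ' (Sum.inl κ₁) (Sum.inl κ₂)))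
    fc1.1 fc0.1 (fun a b _ => fc1.2.2 a b) (fun a b _ => fc0.2.2 a b) fc1.2.1 fc0.2.1 hXc
  exact evenClass_induction
    (E := fun κ κ' κ₁ κ₂ =>
      (zmode Lc (unitS₂ (sfStep Lc (0 + 1)) (smStep 3 Lc (0 + 1)) (T2RecOf 3 Lc (GcombSh Lc) (SpureCombOf tabs cE cVH cΛ) tabs.M cE₂ cB (c • wsym22 M) tabs.vh₂S tabs.mixFF (0 + 1))) κ κ' (Sum.inl κ₁) (Sum.inl κ₂)
      + zmode Lc (unitS₂ (sfStep Lc (0 + 1)) (smStep 3 Lc (0 + 1)) (T2RecOf 3 Lc (GcombSh Lc) (SpureCombOf tabs cE cVH cΛ) tabs.M cE₂ cB (c • wsym22 M) tabs.vh₂S tabs.mixFF (0 + 1))) κ' κ (Sum.inl κ₁) (Sum.inl κ₂)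
      + (zmode Lc (unitS₂ (sfStep Lc (0 + 1)) (smStep 3 Lc (0 + 1)) (T2RecOf 3 Lc (GcombSh Lc) (SpureCombOf tabs cE cVH cΛ) tabs.M cE₂ cB (c • wsym22 M) tabs.vh₂S tabs.mixFF (0 + 1))) κ κ' (Sum.inl κ₂) (Sum.inl κ₁)
      + zmode Lc (unitS₂ (sfStep Lc (0 + 1)) (smStep 3 Lc (0 + 1)) (T2RecOf 3 Lc (GcombSh Lc) (SpureCombOf tabs cE cVH cΛ) tabs.M cE₂ cB (c • wsym22 M) tabs.vh₂S tabs.mixFF (0 + 1))) κ' κ (Sum.inl κ₂) (Sum.inl κ₁)))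
      = (zmode Lc (unitS₂ (sfStep Lc 0) (smStep 3 Lc 0) (T2RecOf 3 Lc (GcombSh Lc) (SpureCombOf tabs cE cVH cΛ) tabs.M cE₂ cB (c • wsym22 M) tabs.vh₂S tabs.mixFF 0)) κ κ' (Sum.inl κ₁) (Sum.inl κ₂)
      + zmode Lc (unitS₂ (sfStep Lc 0) (smStep 3 Lc 0) (T2RecOf 3 Lc (GcombSh Lc) (SpureCombOf tabs cE cVH cΛ) tabs.M cE₂ cB (c • wsym22 M) tabs.vh₂S tabs.mixFF 0)) κ' κ (Sum.inl κ₁) (Sum.inl κ₂)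
      + (zmode Lc (unitS₂ (sfStep Lc 0) (smStep 3 Lc 0) (T2RecOf 3 Lc (GcombSh Lc) (SpureCombOf tabs cE cVH cΛ) tabs.M cE₂ cB (c • wsym22 M) tabs.vh₂S tabs.mixFF 0)) κ κ' (Sum.inl κ₂) (Sum.inl κ₁)
      + zmode Lc (unitS₂ (sfStep Lc 0) (smStep 3 Lc 0) (T2RecOf 3 Lc (GcombSh Lc) (SpureCombOf tabs cE cVH cΛ) tabs.M cE₂ cB (c • wsym22 M) tabs.vh₂S tabs.mixFF 0)) κ' κ (Sum.inl κ₂) (Sum.inl κ₁))))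
    (fun κ κ' κ₁ κ₂ h => by linarith [h]) (fun κ κ' κ₁ κ₂ h => by linarith [h]) hWf hYf hXf κ κ' κ₁ κ₂ heven

end Summit.QuantumFields.BalabanUV.Beta.GAN24.CombChartChargeLevelZeroEvenRow

end
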